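import Literature.NumberTheory.Automorphic.AutomorphicRepsGLAnalyticVectors
import Literature.NumberTheory.Automorphic.HarishChandraDiracGL
import Literature.NumberTheory.Automorphic.HarishChandraConvolutionAdelic
import Literature.NumberTheory.Automorphic.AutomorphicGLnOfBasicEstimate
import Literature.NumberTheory.Automorphic.GLnCuspidalSiegelEstimate
import Literature.Analysis.OperatorTheory.AlgebraicVectorBounds
import HarnessLib

/-!
# Finite-dimensionality of spaces of cusp forms by compact operators, in uniform form:
# a space of `L²`-representable cusp forms on `GL_n(𝔸_K)` on which the Casimir operator and the
# `𝔨`-derivatives are UNIFORMLY algebraic is finite-dimensional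

Topic `NumberTheory/Automorphic`. The classical proof that the cusp forms of a fixed level, fixed
`K_∞`-types and fixed `Z(𝔤)`-character form a finite-dimensional space (Harish-Chandra, LNM 62
(1968), Thm. 1; Borel 1997, Thm. 8.5 with §9; Gelbart 1975, Lemma 5.2; Getz–Hahn 2024, Thm. 9.1.1)
has two inputs: (i) the compactness of the convolution operators `R(η)` on `L²_cusp` (in the tree a
THEOREM for `GL_n`: `GLnCuspidalSpectrum.isCompactOperator_smoothedVector_of_basicEstimate` with
`GLnCuspidalSpectrum.norm_smoothedForm_le_of_isSiegelSetGL_holds`), and (ii) an identity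
`R(η) φ = φ` on the space, which in print is Harish-Chandra's `φ = φ ∗ α` (elliptic regularity /
analytic vectors; in the tree only a named fact, `AutomorphicRepsGL.exists_convolution_eq_self`).
This file proves the finite-dimensionality WITHOUT (ii), replacing the exact identity by the
approximate one that unitarity and `Z(𝔤)`/`𝔨`-algebraicity give for free:

* `IsL2LieStable.exists_norm_cl_lieRep_le` — **the uniform derivative bound**. Let `W` be an
  `L²`-Lie-stable space of functions on `GL_n(𝔸_K)` (`IsL2LieStable`, `AutomorphicRepsGLAnalyticVectors`:
  archimedean-smooth, `𝔤`-stable, inversions of `ℒ²`-functions on `GL_n(𝔸_K) ⧸ A_G GL_n(K)` with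
  injective class map `cl`), `V₀ ≤ W`, and suppose ONE non-zero polynomial `P` kills the Casimir
  operator `Ω` on every `φ ∈ V₀` and, for each `𝔨`-generator `Y_p`, one non-zero polynomial `P_p`
  kills `Y_p` on every `φ ∈ V₀`. Then there is `C` with `‖[X φ]‖ ≤ C ‖X‖ ‖[φ]‖` for ALL `φ ∈ V₀` and
  all `X ∈ 𝔤`: by skew-symmetry of the Lie derivatives in `L²` (`inner_cl_lieRep_add_inner_cl_lieRep`)
  `∑_p ‖[X_p φ]‖² = -Re ⟪[∑ X_p² φ], [φ]⟫`, by the Casimir identity `2 ∑ X_p² = 2 Ω + ∑ Y_p²`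
  (`two_smul_laplacian_apply`, `RealCasimirGL`) this is `-Re ⟪[Ω φ], [φ]⟫ + ½ ∑ ‖[Y_p φ]‖²`, and the
  two terms are `≤ Λ_P ‖[φ]‖²`, `≤ Λ_{P_p}² ‖[φ]‖²` by the operator bounds of
  `Literature.Analysis.OperatorTheory.AlgebraicVectorBounds` (`Ω` is symmetric, `Y_p` skew).
* `IsL2LieStable.norm_rightRegular_expMem_cl_sub_le` — `‖R(exp X)[φ] - [φ]‖ ≤ ‖[X φ]‖` (fundamental
  theorem of calculus along the unitary one-parameter group,
  `rightRegular_expMem_toLp_eq_add_intervalIntegral`).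
* `exists_nhds_one_subset_expGL_ball` — small elements of `GL_n(K_∞)` are exponentials of small
  matrices (the logarithmic chart `exists_contDiffAt_log`).
* `IsL2LieStable.finiteDimensional_of_aeval_eq_zero` — **the theorem**: if moreover the `φ ∈ V₀`
  are right invariant under a level `{1} × U₀` and their classes lie in `L²_cusp`, then `V₀` is
  finite-dimensional. Proof: pick a Dirac weight `β` on `GL_n(K_∞)` (`exists_dirac_admissibleWeightsGL`)
  supported where `‖R(x)[φ] - [φ]‖ ≤ ½ ‖[φ]‖` on `V₀`; for the test function `η = β ⊗ 1_{U₀}`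
  (`adelicWeight`) one gets `‖R(η) v - v‖ ≤ ½ ‖v‖` on the closure of `cl(V₀)` in `L²_cusp`; `R(η)` is
  compact there, so that closure is finite-dimensional
  (`Literature.Analysis.OperatorTheory.finiteDimensional_of_isCompactOperator_of_norm_sub_le`), and
  `cl` is injective.

Applied (in the sequel) to the span of the right convolutions `φ ∗ β̌` of ONE cusp form `φ` by the
`Ad K_∞`-invariant test functions — on which `Ω` and the `Y_p` are uniformly algebraic because they
commute with `∗ β̌` and `φ` is `Z(𝔤)`-finite and `K_∞`-finite — it yields Harish-Chandra's
convolution identity, uniform moderate growth and boundedness for cusp forms. Everything here is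
proved; there are no definitions.

## References

* A. Borel, *Automorphic forms on `SL₂(ℝ)`*, Cambridge Tracts in Math. 130 (1997), Thm. 8.5, §9
  [Borel1997].
* Harish-Chandra, *Automorphic forms on semisimple Lie groups*, LNM 62 (1968), §2, Thm. 1.
* Harish-Chandra, *Representations of a semisimple Lie group on a Banach space. I*, Trans. AMS 75
  (1953), §9, §11 [HarishChandraTAMS1953].
* J. R. Getz, H. Hahn, *An Introduction to Automorphic Representations*, GTM 300 (2024), Thm. 9.1.1,
  Lemma 9.3.2 [GetzHahn2024].
-/

noncomputable section

-- Mathlib idiom (Mathlib/Algebra/Lie/OfAssociative.lean); needed to mention Lie subalgebras of matrix algebras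
attribute [local instance 100] LieRing.ofAssociativeRing

open scoped MatrixGroups Matrix ContDiff Topology InnerProductSpace Classical
open Filter UniversalEnvelopingAlgebra Polynomial Set
open NumberField NumberField.mixedEmbedding IsDedekindDomain
open _root_.MeasureTheory _root_.MeasureTheory.Measure

namespace Literature.NumberTheory.Automorphic

-- `M_n(K ⊗ ℝ)` is finite-dimensional over `ℝ` (the tree's instance, as in `HarishChandraDiracGL`)
attribute [local instance] finiteDimensional_matrix_mixedSpace

variable {n : ℕ} {K : Type} [Field K] [NumberField K] {hcpt : isCompact_glFiniteIntegralLevel n K}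
  {μ : Measure (AdelicGroupData.gl n K).automorphicQuotient}
  [(AdelicGroupData.gl n K).IsAutomorphicMeasure μ]
  {W : Submodule ℂ ((AdelicGroupData.gl n K).Adelic → ℂ)}
  {S : Type*} [Fintype S]

/-! ### 1. The uniform derivative bound -/

section DerivativeBound

-- the scoped operator norm on `𝔤𝔩_n(K_∞)`
open scoped Matrix.Norms.Operator

set_option synthInstance.maxHeartbeats 200000 in
set_option backward.isDefEq.respectTransparency false in
/-- **Coordinates with respect to the unit generators.** The unit generators `X_p = u_s E_{ab}` of a
self-dual system of units span `𝔤𝔩_n(K_∞)` (`exists_repr_unitGen`), so there is a real linear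
coordinate map `x` with `X = ∑_p x(X)_p X_p` for all `X`, bounded: `|x(X)_p| ≤ C ‖X‖`. [folklore] -/
theorem exists_coord_unitGen (F : SelfDualUnits (mixedSpace K) S) :
    ∃ (x : Matrix (Fin n) (Fin n) (mixedSpace K) →ₗ[ℝ] (S × Fin n × Fin n → ℝ)) (C : ℝ), 0 ≤ C ∧
      (∀ X : (archGroupGL n K).lie,
        X = ∑ p, x (X : Matrix (Fin n) (Fin n) (mixedSpace K)) p • (unitGen F p : (archGroupGL n K).lie)) ∧
      ∀ (X : Matrix (Fin n) (Fin n) (mixedSpace K)) (p : S × Fin n × Fin n), |x X p| ≤ C * ‖X‖ := by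
  -- the synthesis map `c ↦ ∑ c_p X_p`, onto by `exists_repr_unitGen`
  let T : (S × Fin n × Fin n → ℝ) →ₗ[ℝ] Matrix (Fin n) (Fin n) (mixedSpace K) :=
    { toFun := fun c => ∑ p, c p • ((unitGen (N := Fin n) F p : (archGroupGL n K).lie) :
        Matrix (Fin n) (Fin n) (mixedSpace K))
      map_add' := fun c d => by
        simp only [Pi.add_apply, add_smul, Finset.sum_add_distrib]
      map_smul' := fun a c => by
        simp only [Pi.smul_apply, smul_eq_mul, mul_smul, RingHom.id_apply, Finset.smul_sum] }
  have hT : ∀ c, T c = ∑ p, c p • ((unitGen (N := Fin n) F p : (archGroupGL n K).lie) :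
      Matrix (Fin n) (Fin n) (mixedSpace K)) := fun c => rfl
  set TL : (S × Fin n × Fin n → ℝ) →L[ℝ] Matrix (Fin n) (Fin n) (mixedSpace K) :=
    LinearMap.toContinuousLinearMap T with hTL
  have hsurj : TL.range = ⊤ := by
    rw [eq_top_iff]
    rintro Y -
    obtain ⟨c, hc⟩ := exists_repr_unitGen (N := Fin n) F ⟨Y, by
      change Y ∈ (archGroupGL n K).lie; rw [archGroupGL_lie]; exact LieSubalgebra.mem_top Y⟩
    refine ⟨c, ?_⟩
    have hc' := congrArg (fun Z : (archGroupGL n K).lie => (Z : Matrix (Fin n) (Fin n) (mixedSpace K))) hc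
    simp only [AddSubmonoidClass.coe_finsetSum, SetLike.val_smul] at hc'
    change T c = Y
    rw [hT]
    exact hc'.symm
  obtain ⟨g, hg⟩ := TL.exists_rightInverse_of_surjective hsurj
  obtain ⟨Cg, hCg0, hCg⟩ := g.bound
  refine ⟨(g : Matrix (Fin n) (Fin n) (mixedSpace K) →ₗ[ℝ] (S × Fin n × Fin n → ℝ)), Cg,
    hCg0.le, fun X => ?_, fun X p => ?_⟩
  · apply Subtype.ext
    have h1 : TL (g (X : Matrix (Fin n) (Fin n) (mixedSpace K))) = X := by
      rw [← ContinuousLinearMap.comp_apply, hg, ContinuousLinearMap.id_apply]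
    change (X : Matrix (Fin n) (Fin n) (mixedSpace K)) = _
    simp only [AddSubmonoidClass.coe_finsetSum, SetLike.val_smul]
    conv_lhs => rw [← h1]
    rfl
  · calc |g X p| = ‖g X p‖ := (Real.norm_eq_abs _).symm
      _ ≤ ‖g X‖ := norm_le_pi_norm (g X) p
      _ ≤ Cg * ‖X‖ := hCg X

set_option maxHeartbeats 1600000 in
set_option synthInstance.maxHeartbeats 200000 in
set_option backward.isDefEq.respectTransparency false in
/-- **The uniform derivative bound** (Harish-Chandra 1953, §11; Borel 1997, §8–9, in uniform form).
Let `W` be `L²`-Lie-stable (`IsL2LieStable`), `V₀ ≤ W`, `F` a self-dual system of units of `K_∞`, and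
suppose one non-zero polynomial `P` satisfies `P(Ω) φ = 0` for all `φ ∈ V₀` (`Ω` the Casimir
operator of `F` acting through `lieRep`) and, for every `p`, one non-zero polynomial `P_p` satisfies
`P_p(Y_p) φ = 0` for all `φ ∈ V₀` (`Y_p` the `𝔨`-generators). Then there is `C ≥ 0` with
`‖[X φ]‖ ≤ C ‖X‖ ‖[φ]‖` for all `φ ∈ V₀` and `X ∈ 𝔤𝔩_n(K_∞)`. Proof: with the inner product of `L²`
pulled back to `W` (`innerCore`) every `Z ∈ 𝔤` acts skew-symmetrically
(`inner_cl_lieRep_add_inner_cl_lieRep`), so `∑_p ‖X_p φ‖² = -Re ⟪∑_p X_p² φ, φ⟫`; by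
`2 ∑ X_p² = 2 Ω + ∑ Y_p²` (`two_smul_laplacian_apply`) this equals `-Re ⟪Ω φ, φ⟫ + ½ ∑ ‖Y_p φ‖²`;
`Ω` is symmetric and `Y_p` skew, so `|⟪Ω φ, φ⟫| ≤ Λ_P ‖φ‖²` and `‖Y_p φ‖ ≤ Λ_p ‖φ‖`
(`norm_inner_le_rootSum_of_symmetric_of_aeval_apply_eq_zero`,
`norm_apply_le_rootSum_of_skew_of_aeval_apply_eq_zero`); finally `X = ∑ x_p X_p` with
`|x_p| ≤ C₀ ‖X‖` (`exists_coord_unitGen`) and Cauchy–Schwarz. [cite: HarishChandraTAMS1953, §11 (p. 230)] -/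
theorem IsL2LieStable.exists_norm_cl_lieRep_le (h : IsL2LieStable (AutomorphyDatum.gl n K hcpt) μ W)
    (F : SelfDualUnits (mixedSpace K) S) (V₀ : Submodule ℂ W) {P : ℂ[X]} (hP : P ≠ 0)
    (hΩ : ∀ φ ∈ V₀, aeval (envelopingAction
      (h.isLieStableSmooth.lieRep (archGroupGL_lie n K) (archGroupGL_carrier n K)) (casimirU F)) P φ = 0)
    (Pk : S × Fin n × Fin n → ℂ[X]) (hPk : ∀ p, Pk p ≠ 0)
    (hk : ∀ p, ∀ φ ∈ V₀, aeval (h.isLieStableSmooth.lieRep (archGroupGL_lie n K) (archGroupGL_carrier n K)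
      (kGen F p)) (Pk p) φ = 0) :
    ∃ C : ℝ, 0 ≤ C ∧ ∀ φ ∈ V₀, ∀ X : (AutomorphyDatum.gl n K hcpt).arch.lie,
      ‖h.cl (h.isLieStableSmooth.lieRep (archGroupGL_lie n K) (archGroupGL_carrier n K) X φ)‖ ≤
        C * ‖(X : Matrix (Fin n) (Fin n) (mixedSpace K))‖ * ‖h.cl φ‖ := by
  set hH := archGroupGL_lie n K
  set hc := archGroupGL_carrier n K
  set L := h.isLieStableSmooth.lieRep hH hc with hL_def
  -- `W` as an inner product space through `cl`
  letI : NormedAddCommGroup W := @InnerProductSpace.Core.toNormedAddCommGroup ℂ W _ _ _ h.innerCore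
  letI : InnerProductSpace ℂ W := InnerProductSpace.ofCore _
  have hnorm : ∀ φ : W, ‖φ‖ = ‖h.cl φ‖ := fun φ => by
    rw [@norm_eq_sqrt_re_inner ℂ, @norm_eq_sqrt_re_inner ℂ]
    rfl
  have hinner : ∀ φ ψ : W, ⟪φ, ψ⟫_ℂ = ⟪h.cl φ, h.cl ψ⟫_ℂ := fun _ _ => rfl
  -- skew-symmetry of every Lie derivative
  have hskew : ∀ (Z : (AutomorphyDatum.gl n K hcpt).arch.lie) (u w : W), ⟪L Z u, w⟫_ℂ = -⟪u, L Z w⟫_ℂ := by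
    intro Z u w
    rw [eq_neg_iff_add_eq_zero]
    exact h.inner_cl_lieRep_add_inner_cl_lieRep hH hc Z u w
  -- symmetry of squares
  have hsq : ∀ (Z : (AutomorphyDatum.gl n K hcpt).arch.lie) (u w : W),
      ⟪L Z (L Z u), w⟫_ℂ = ⟪u, L Z (L Z w)⟫_ℂ := fun Z u w => by
    rw [hskew, hskew, neg_neg]
  -- the operators
  set Xop : S × Fin n × Fin n → Module.End ℂ W := fun p => L (unitGen F p) with hXop
  set Yop : S × Fin n × Fin n → Module.End ℂ W := fun p => L (kGen F p) with hYop
  set Ω : Module.End ℂ W := envelopingAction L (casimirU F) with hΩ_def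
  -- the Casimir identity on `W`
  have hcas : ∀ u : W, (2 : ℂ) • (∑ p, Xop p (Xop p u)) = (2 : ℂ) • Ω u + ∑ p, Yop p (Yop p u) := by
    intro u
    have h2 := h.isLieStableSmooth.two_smul_laplacian_apply F u
    rw [← Complex.coe_smul, ← Complex.coe_smul, Complex.ofReal_ofNat] at h2
    exact h2
  -- `Ω` is symmetric
  have hΩsymm : ∀ u w : W, ⟪Ω u, w⟫_ℂ = ⟪u, Ω w⟫_ℂ := by
    intro u w
    have hu := hcas u
    have hw := hcas w
    have e1 : ⟪(2 : ℂ) • Ω u, w⟫_ℂ = ⟪(2 : ℂ) • (∑ p, Xop p (Xop p u)) - ∑ p, Yop p (Yop p u), w⟫_ℂ := by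
      rw [hu, add_sub_cancel_right]
    have e2 : ⟪u, (2 : ℂ) • Ω w⟫_ℂ = ⟪u, (2 : ℂ) • (∑ p, Xop p (Xop p w)) - ∑ p, Yop p (Yop p w)⟫_ℂ := by
      rw [hw, add_sub_cancel_right]
    have e3 : ⟪(2 : ℂ) • (∑ p, Xop p (Xop p u)) - ∑ p, Yop p (Yop p u), w⟫_ℂ =
        ⟪u, (2 : ℂ) • (∑ p, Xop p (Xop p w)) - ∑ p, Yop p (Yop p w)⟫_ℂ := by
      simp only [inner_sub_left, inner_sub_right, inner_smul_left, inner_smul_right, sum_inner,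
        inner_sum, hXop, hYop, hsq, map_ofNat]
    have e4 : (starRingEnd ℂ) (2 : ℂ) * ⟪Ω u, w⟫_ℂ = (2 : ℂ) * ⟪u, Ω w⟫_ℂ := by
      rw [← inner_smul_left, ← inner_smul_right, e1, e2, e3]
    rw [map_ofNat] at e4
    exact mul_left_cancel₀ two_ne_zero e4
  -- the bounds from algebraicity
  set Λ : ℝ := (P.roots.map fun z => ‖z‖).sum with hΛ
  set Λk : S × Fin n × Fin n → ℝ := fun p => (((Pk p).comp (C (-Complex.I) * X)).roots.map fun z => ‖z‖).sum
    with hΛk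
  have hΛ0 : 0 ≤ Λ := Multiset.sum_nonneg fun x hx => by
    obtain ⟨z, -, rfl⟩ := Multiset.mem_map.1 hx; exact norm_nonneg z
  have hΛk0 : ∀ p, 0 ≤ Λk p := fun p => Multiset.sum_nonneg fun x hx => by
    obtain ⟨z, -, rfl⟩ := Multiset.mem_map.1 hx; exact norm_nonneg z
  have hΩbound : ∀ φ : W, φ ∈ V₀ → ‖⟪Ω φ, φ⟫_ℂ‖ ≤ Λ * ‖φ‖ ^ 2 := fun φ hφ =>
    Literature.Analysis.OperatorTheory.norm_inner_le_rootSum_of_symmetric_of_aeval_apply_eq_zero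
      Ω hΩsymm hP (hΩ φ hφ)
  have hYbound : ∀ p (φ : W), φ ∈ V₀ → ‖Yop p φ‖ ≤ Λk p * ‖φ‖ := fun p φ hφ =>
    Literature.Analysis.OperatorTheory.norm_apply_le_rootSum_of_skew_of_aeval_apply_eq_zero
      (Yop p) (hskew (kGen F p)) (hPk p) (hk p φ hφ)
  -- the sum of squares
  set M₀ : ℝ := Λ + (∑ p, Λk p ^ 2) / 2 with hM₀
  have hM₀0 : 0 ≤ M₀ := by positivity
  have hsumsq : ∀ φ : W, φ ∈ V₀ → ∑ p, ‖Xop p φ‖ ^ 2 ≤ M₀ * ‖φ‖ ^ 2 := by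
    intro φ hφ
    -- `‖X_p φ‖² = -Re ⟪X_p² φ, φ⟫`
    have e1 : ∀ p, (‖Xop p φ‖ ^ 2 : ℝ) = -RCLike.re ⟪Xop p (Xop p φ), φ⟫_ℂ := fun p => by
      rw [hskew, map_neg, neg_neg, ← @inner_self_eq_norm_sq ℂ]
    have e2 : (∑ p, ‖Xop p φ‖ ^ 2 : ℝ) = -∑ p, RCLike.re ⟪Xop p (Xop p φ), φ⟫_ℂ := by
      rw [← Finset.sum_neg_distrib]
      exact Finset.sum_congr rfl fun p _ => e1 p
    -- the Casimir identity inside the inner product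
    have e3 : (∑ p, RCLike.re ⟪Xop p (Xop p φ), φ⟫_ℂ) + ∑ p, RCLike.re ⟪Xop p (Xop p φ), φ⟫_ℂ =
        RCLike.re ⟪Ω φ, φ⟫_ℂ + RCLike.re ⟪Ω φ, φ⟫_ℂ + ∑ p, RCLike.re ⟪Yop p (Yop p φ), φ⟫_ℂ := by
      have h1 := congrArg (fun w : W => ⟪w, φ⟫_ℂ) (hcas φ)
      simp only [inner_add_left, inner_smul_left, map_ofNat] at h1
      rw [two_mul, two_mul] at h1
      simp only [sum_inner] at h1
      have h2 := congrArg RCLike.re h1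
      simp only [map_add, _root_.map_sum] at h2
      exact h2
    have e4 : ∀ p, RCLike.re ⟪Yop p (Yop p φ), φ⟫_ℂ = -‖Yop p φ‖ ^ 2 := fun p => by
      rw [hskew, map_neg, @inner_self_eq_norm_sq ℂ]
    have e5 : (∑ p, ‖Xop p φ‖ ^ 2 : ℝ) = -RCLike.re ⟪Ω φ, φ⟫_ℂ + (∑ p, ‖Yop p φ‖ ^ 2) / 2 := by
      rw [e2]
      simp only [e4, Finset.sum_neg_distrib] at e3
      linarith
    rw [e5, hM₀, add_mul]
    refine add_le_add ?_ ?_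
    · calc -RCLike.re ⟪Ω φ, φ⟫_ℂ ≤ ‖⟪Ω φ, φ⟫_ℂ‖ := by
            refine (neg_le_abs _).trans ?_
            rw [← Real.norm_eq_abs]
            exact RCLike.norm_re_le_norm _
        _ ≤ Λ * ‖φ‖ ^ 2 := hΩbound φ hφ
    · rw [div_mul_eq_mul_div, Finset.sum_mul]
      refine div_le_div_of_nonneg_right (Finset.sum_le_sum fun p _ => ?_) zero_le_two
      rw [← mul_pow]
      exact pow_le_pow_left₀ (norm_nonneg _) (hYbound p φ hφ) 2
  -- coordinates
  obtain ⟨x, C₀, hC₀, hrepr, hxle⟩ := exists_coord_unitGen (n := n) (K := K) F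
  set Cn : ℝ := (Fintype.card (S × Fin n × Fin n) : ℝ) with hCn
  refine ⟨C₀ * Cn * Real.sqrt M₀, by positivity, fun φ hφ X => ?_⟩
  -- `X φ = ∑ x_p X_p φ`
  have hX : L X φ = ∑ p, ((x (X : Matrix (Fin n) (Fin n) (mixedSpace K)) p : ℝ) : ℂ) • Xop p φ := by
    conv_lhs => rw [hrepr X]
    rw [hL_def, h.isLieStableSmooth.lieRep_sum_smul hH hc, LinearMap.sum_apply]
    rfl
  rw [← hnorm, ← hnorm]
  change ‖L X φ‖ ≤ _
  rw [hX]
  calc ‖∑ p, ((x (X : Matrix (Fin n) (Fin n) (mixedSpace K)) p : ℝ) : ℂ) • Xop p φ‖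
      ≤ ∑ p, ‖((x (X : Matrix (Fin n) (Fin n) (mixedSpace K)) p : ℝ) : ℂ) • Xop p φ‖ := norm_sum_le _ _
    _ ≤ ∑ p, C₀ * ‖(X : Matrix (Fin n) (Fin n) (mixedSpace K))‖ * ‖Xop p φ‖ := by
        refine Finset.sum_le_sum fun p _ => ?_
        rw [_root_.norm_smul, Complex.norm_real, Real.norm_eq_abs]
        exact mul_le_mul_of_nonneg_right (hxle _ p) (norm_nonneg _)
    _ = C₀ * ‖(X : Matrix (Fin n) (Fin n) (mixedSpace K))‖ * ∑ p, ‖Xop p φ‖ := by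
        rw [Finset.mul_sum]
    _ ≤ C₀ * ‖(X : Matrix (Fin n) (Fin n) (mixedSpace K))‖ * (Cn * Real.sqrt M₀ * ‖φ‖) := by
        refine mul_le_mul_of_nonneg_left ?_ (by positivity)
        -- Cauchy–Schwarz: `∑ a_p ≤ card · sqrt (∑ a_p²) ≤ card · sqrt(M₀) ‖φ‖`
        have hcs : ∀ p, ‖Xop p φ‖ ≤ Real.sqrt M₀ * ‖φ‖ := by
          intro p
          have h1 : ‖Xop p φ‖ ^ 2 ≤ M₀ * ‖φ‖ ^ 2 :=
            le_trans (Finset.single_le_sum (f := fun q => ‖Xop q φ‖ ^ 2) (fun _ _ => sq_nonneg _)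
              (Finset.mem_univ p)) (hsumsq φ hφ)
          have h2 : ‖Xop p φ‖ ^ 2 ≤ (Real.sqrt M₀ * ‖φ‖) ^ 2 := by
            rwa [mul_pow, Real.sq_sqrt hM₀0]
          exact (pow_le_pow_iff_left₀ (norm_nonneg _) (by positivity) two_ne_zero).1 h2
        calc ∑ p, ‖Xop p φ‖ ≤ ∑ _p : S × Fin n × Fin n, Real.sqrt M₀ * ‖φ‖ :=
              Finset.sum_le_sum fun p _ => hcs p
          _ = Cn * Real.sqrt M₀ * ‖φ‖ := by
              rw [Finset.sum_const, nsmul_eq_mul, hCn, Finset.card_univ, mul_assoc]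
    _ = C₀ * Cn * Real.sqrt M₀ * ‖(X : Matrix (Fin n) (Fin n) (mixedSpace K))‖ * ‖φ‖ := by ring

end DerivativeBound

/-! ### 2. The near-identity estimate along the unitary one-parameter groups -/

section NearIdentity

set_option maxHeartbeats 800000 in
set_option backward.isDefEq.respectTransparency false in
/-- **`‖R(exp X)[φ] - [φ]‖ ≤ ‖[X φ]‖`** for `φ` in an `L²`-Lie-stable space: by the fundamental
theorem of calculus along the unitary one-parameter group (`rightRegular_expMem_toLp_eq_add_intervalIntegral`
of `AutomorphicFormsL2DerivativeIntegral`), `R(exp X)[φ] = [φ] + ∫₀¹ R(exp sX)[X φ] ds`, and the integrand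
has norm `‖[X φ]‖` (`R` is isometric). Harish-Chandra 1953, §9; Nelson 1959, §2.
[cite: HarishChandraTAMS1953, §9 (p. 227)] -/
theorem IsL2LieStable.norm_rightRegular_expMem_cl_sub_le (h : IsL2LieStable (AutomorphyDatum.gl n K hcpt) μ W)
    (X : (AutomorphyDatum.gl n K hcpt).arch.lie) (φ : W) :
    ‖(AdelicGroupData.gl n K).rightRegular μ
        ((AutomorphyDatum.gl n K hcpt).ofArch ((AutomorphyDatum.gl n K hcpt).arch.expMem X)) (h.cl φ) -
        h.cl φ‖ ≤
      ‖h.cl (h.isLieStableSmooth.lieRep (archGroupGL_lie n K) (archGroupGL_carrier n K) X φ)‖ := by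
  -- representatives of `[φ]` and `[X φ]`
  set φ' : (AdelicGroupData.gl n K).l2Representable μ := ⟨φ, h.le_l2Representable φ.2⟩ with hφ'
  set ψ' : (AdelicGroupData.gl n K).l2Representable μ :=
    ⟨_, h.le_l2Representable
      (h.isLieStableSmooth.lieRep (archGroupGL_lie n K) (archGroupGL_carrier n K) X φ).2⟩ with hψ'
  have hf := (AdelicGroupData.gl n K).memLp_l2Rep φ'
  have hg := (AdelicGroupData.gl n K).memLp_l2Rep ψ'
  have h1 : h.cl φ = hf.toLp _ := rfl
  have h2 : h.cl (h.isLieStableSmooth.lieRep (archGroupGL_lie n K) (archGroupGL_carrier n K) X φ) =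
      hg.toLp _ := rfl
  -- `R(exp X)[φ] = [φ] + ∫₀¹ R(exp sX)[X φ] ds`
  have key := rightRegular_expMem_toLp_eq_add_intervalIntegral (AutomorphyDatum.gl n K hcpt) hf hg
    (by rw [(AdelicGroupData.gl n K).invQuot_l2Rep]; exact h.smooth φ φ.2) X
    (by rw [(AdelicGroupData.gl n K).invQuot_l2Rep, (AdelicGroupData.gl n K).invQuot_l2Rep]; rfl) 1
  rw [one_smul] at key
  rw [h1, h2, key, add_sub_cancel_left]
  calc ‖∫ s in (0 : ℝ)..1, (AdelicGroupData.gl n K).rightRegular μ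
        ((AutomorphyDatum.gl n K hcpt).ofArch ((AutomorphyDatum.gl n K hcpt).arch.expMem (s • X)))
          (hg.toLp _)‖
      ≤ ‖hg.toLp ((AdelicGroupData.gl n K).l2Rep ψ')‖ * |(1 : ℝ) - 0| :=
        intervalIntegral.norm_integral_le_of_norm_le_const fun s _ =>
          ((AdelicGroupData.gl n K).norm_rightRegular_apply μ _ _).le
    _ = ‖hg.toLp ((AdelicGroupData.gl n K).l2Rep ψ')‖ := by rw [sub_zero, abs_one, mul_one]

end NearIdentity

/-! ### 3. The logarithmic chart: small elements of `GL_n(K_∞)` are exponentials of small matrices -/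

section LogChart

-- the scoped operator norm on `𝔤𝔩_n(K_∞)`
open scoped Matrix.Norms.Operator

set_option backward.isDefEq.respectTransparency false in
/-- **Small elements of `GL_n(K_∞)` are exponentials of small matrices**: for every `δ > 0` there is
a neighbourhood `𝒰` of `1` in `GL_n(K_∞)` every element of which is `exp X` with `‖X‖ < δ` (the
logarithm near `1`, `exists_contDiffAt_log`). Knapp 2002, 0.§2. [folklore] -/
theorem exists_nhds_one_subset_expGL_ball {δ : ℝ} (hδ : 0 < δ) :
    ∃ 𝒰 ∈ 𝓝 (1 : GL (Fin n) (mixedSpace K)), ∀ x ∈ 𝒰,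
      ∃ X : Matrix (Fin n) (Fin n) (mixedSpace K), ‖X‖ < δ ∧ x = expGL X := by
  obtain ⟨log, hlog, hlog1, hexp⟩ := exists_contDiffAt_log (A := mixedSpace K) (N := Fin n)
  have hA : {y : Matrix (Fin n) (Fin n) (mixedSpace K) | NormedSpace.exp (log y) = y} ∈
      𝓝 (1 : Matrix (Fin n) (Fin n) (mixedSpace K)) := hexp
  have hB : log ⁻¹' Metric.ball 0 δ ∈ 𝓝 (1 : Matrix (Fin n) (Fin n) (mixedSpace K)) := by
    refine hlog.continuousAt.preimage_mem_nhds ?_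
    rw [hlog1]
    exact Metric.ball_mem_nhds 0 hδ
  refine ⟨Units.val ⁻¹' ({y | NormedSpace.exp (log y) = y} ∩ log ⁻¹' Metric.ball 0 δ), ?_, ?_⟩
  · refine Units.continuous_val.continuousAt.preimage_mem_nhds ?_
    rw [Units.val_one]
    exact Filter.inter_mem hA hB
  · rintro x ⟨hx1, hx2⟩
    refine ⟨log (x : Matrix (Fin n) (Fin n) (mixedSpace K)), ?_, ?_⟩
    · simpa only [Set.mem_preimage, Metric.mem_ball, dist_zero_right] using hx2
    · refine Units.ext ?_
      rw [coe_expGL]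
      exact (hx1 : NormedSpace.exp (log (x : Matrix (Fin n) (Fin n) (mixedSpace K))) = x).symm

end LogChart

/-! ### 4. The finite-dimensionality theorem -/

section Main

attribute [local instance] adelicBorel borelSpace_adelic locallyCompactSpace_adelic
  secondCountableTopology_gl_adelic glInfBorel borelSpace_glInf locallyCompactSpace_glInf
  secondCountableTopology_glInf

variable {U₀ : Subgroup (GL (Fin n) (FiniteAdeleRing (𝓞 K) K))}

/-- `∫ (β ⊗ 1_{U₀}) dg = ∫ β dν` for the level measure `ν = levelArchMeasure U₀` (`integral_levelArchMeasure`).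
[folklore] -/
theorem integral_adelicWeight_eq (hU₀o : IsOpen (U₀ : Set (GL (Fin n) (FiniteAdeleRing (𝓞 K) K))))
    {β : GL (Fin n) (mixedSpace K) → ℝ} (hβ : Continuous β) :
    ∫ g, adelicWeight U₀ β g ∂(adelicHaar n K) = ∫ x, β x ∂(levelArchMeasure n K U₀) := by
  rw [integral_levelArchMeasure hU₀o hβ.aestronglyMeasurable]
  congr 1 with g
  rw [adelicWeight_apply]
  by_cases hg : g ∈ levelSlab n K U₀
  · rw [Set.indicator_of_mem hg, Set.indicator_of_mem hg, mul_one]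
  · rw [Set.indicator_of_notMem hg, Set.indicator_of_notMem hg, mul_zero]

/-- On a vector fixed by `{1} × U₀`, `R(g) = R(g_∞, 1)` for `g` in the slab `G_∞ × U₀`
(`g = (g_∞, 1)(1, g_f)`). [folklore] -/
theorem rightRegular_eq_of_mem_levelSlab {v : (AdelicGroupData.gl n K).L2 μ}
    (hv : ∀ u ∈ U₀, (AdelicGroupData.gl n K).rightRegular μ (GLn.ofFiniteAdelic n K u) v = v)
    {g : (AdelicGroupData.gl n K).Adelic} (hg : g ∈ levelSlab n K U₀) :
    (AdelicGroupData.gl n K).rightRegular μ g v =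
      (AdelicGroupData.gl n K).rightRegular μ (GLn.ofInfiniteAdelic n K (GLn.toMixedAdelic n K g)) v := by
  conv_lhs => rw [← GLn.ofInfiniteAdelic_mul_ofFiniteAdelic g]
  rw [map_mul]
  change (AdelicGroupData.gl n K).rightRegular μ _ ((AdelicGroupData.gl n K).rightRegular μ _ v) = _
  rw [hv _ (mem_levelSlab_iff.1 hg)]

-- the scoped operator norm on `𝔤𝔩_n(K_∞)`
open scoped Matrix.Norms.Operator

set_option maxHeartbeats 1600000 in
set_option backward.isDefEq.respectTransparency false in
/-- **Finite-dimensionality by compact operators, uniform form** (Harish-Chandra, LNM 62, Thm. 1;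
Borel 1997, Thm. 8.5 and §9; Gelbart 1975, Lemma 5.2; Getz–Hahn 2024, Thm. 9.1.1 — but with an
approximate identity in place of Harish-Chandra's `φ = φ ∗ α`). Let `W` be an `L²`-Lie-stable space of
functions on `GL_n(𝔸_K)` (`IsL2LieStable`), `V₀ ≤ W` a subspace whose elements are right invariant under
a level `{1} × U₀` (`U₀` compact open) and have their `L²`-classes in `L²_cusp`, and suppose the Casimir
operator of a self-dual system of units of `K_∞` and its `𝔨`-generators are uniformly algebraic on `V₀`
(one non-zero polynomial each, killing them on every `φ ∈ V₀`). Then `V₀` is finite-dimensional.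
Indeed by `exists_norm_cl_lieRep_le` and `norm_rightRegular_expMem_cl_sub_le` there is a neighbourhood
of `1` in `GL_n(K_∞)` (`exists_nhds_one_subset_expGL_ball`) on which `‖R(x, 1)[φ] - [φ]‖ ≤ ½ ‖[φ]‖`
for all `φ ∈ V₀`; for a Dirac weight `β` supported there (`exists_dirac_admissibleWeightsGL`) and the
test function `η = β ⊗ 1_{U₀}`, `‖R(η) v - v‖ ≤ ½ ‖v‖` on the closure of `cl(V₀)` in `L²_cusp` (the
`v` there are `U₀`-fixed, `rightRegular_mul_ofFiniteAdelic_toLp`); `R(η)` is compact on `L²_cusp`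
(`GLnCuspidalSpectrum.isCompactOperator_smoothedVector_of_basicEstimate` with the proved basic
estimate `norm_smoothedForm_le_of_isSiegelSetGL_holds`), so that closure is finite-dimensional
(`finiteDimensional_of_isCompactOperator_of_norm_sub_le`), and `cl` is injective.
[cite: Borel1997, Thm. 8.5 and 9.6] -/
theorem IsL2LieStable.finiteDimensional_of_aeval_eq_zero (h : IsL2LieStable (AutomorphyDatum.gl n K hcpt) μ W)
    (F : SelfDualUnits (mixedSpace K) S) (V₀ : Submodule ℂ W)
    (hU₀o : IsOpen (U₀ : Set (GL (Fin n) (FiniteAdeleRing (𝓞 K) K))))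
    (hU₀c : IsCompact (U₀ : Set (GL (Fin n) (FiniteAdeleRing (𝓞 K) K))))
    (hlev : ∀ φ ∈ V₀, IsRightInvariantUnder (U₀.map (GLn.ofFiniteAdelic n K)) ((φ : W) : (AdelicGroupData.gl n K).Adelic → ℂ))
    (hcusp : ∀ φ ∈ V₀, h.cl φ ∈ cuspidalSubspace n K μ)
    {P : ℂ[X]} (hP : P ≠ 0)
    (hΩ : ∀ φ ∈ V₀, aeval (envelopingAction
      (h.isLieStableSmooth.lieRep (archGroupGL_lie n K) (archGroupGL_carrier n K)) (casimirU F)) P φ = 0)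
    (Pk : S × Fin n × Fin n → ℂ[X]) (hPk : ∀ p, Pk p ≠ 0)
    (hk : ∀ p, ∀ φ ∈ V₀, aeval (h.isLieStableSmooth.lieRep (archGroupGL_lie n K) (archGroupGL_carrier n K)
      (kGen F p)) (Pk p) φ = 0) :
    FiniteDimensional ℂ V₀ := by
  set hH := archGroupGL_lie n K
  set hc := archGroupGL_carrier n K
  set 𝒟 := AutomorphyDatum.gl n K hcpt with h𝒟
  set R := (AdelicGroupData.gl n K).rightRegular μ with hR
  -- Step 1: the uniform near-identity estimate on `V₀`
  obtain ⟨C, hC0, hC⟩ := h.exists_norm_cl_lieRep_le F V₀ hP hΩ Pk hPk hk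
  set δ : ℝ := 1 / (2 * C + 2) with hδ
  have hδ0 : 0 < δ := by rw [hδ]; positivity
  have hCδ : C * δ ≤ 1 / 2 := by
    rw [hδ, mul_one_div, div_le_iff₀ (by positivity)]
    linarith
  obtain ⟨𝒰, h𝒰, h𝒰exp⟩ := exists_nhds_one_subset_expGL_ball (n := n) (K := K) hδ0
  have hnear : ∀ φ ∈ V₀, ∀ x ∈ 𝒰, ‖R (GLn.ofInfiniteAdelic n K x) (h.cl φ) - h.cl φ‖ ≤ 1 / 2 * ‖h.cl φ‖ := by
    intro φ hφ x hx
    obtain ⟨X, hX, rfl⟩ := h𝒰exp x hx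
    set Xl : 𝒟.arch.lie := ⟨X, by change X ∈ (archGroupGL n K).lie; rw [archGroupGL_lie]; exact LieSubalgebra.mem_top X⟩
    have he1 : GLn.ofInfiniteAdelic n K (expGL X) = 𝒟.ofArch (𝒟.arch.expMem Xl) := rfl
    rw [he1]
    calc ‖R (𝒟.ofArch (𝒟.arch.expMem Xl)) (h.cl φ) - h.cl φ‖
        ≤ ‖h.cl (h.isLieStableSmooth.lieRep hH hc Xl φ)‖ := h.norm_rightRegular_expMem_cl_sub_le Xl φ
      _ ≤ C * ‖(Xl : Matrix (Fin n) (Fin n) (mixedSpace K))‖ * ‖h.cl φ‖ := hC φ hφ Xl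
      _ ≤ C * δ * ‖h.cl φ‖ := by
          refine mul_le_mul_of_nonneg_right (mul_le_mul_of_nonneg_left hX.le hC0) (norm_nonneg _)
      _ ≤ 1 / 2 * ‖h.cl φ‖ := mul_le_mul_of_nonneg_right hCδ (norm_nonneg _)
  -- Step 2: a Dirac weight supported in `𝒰` and its adelic test function
  set ν : Measure (GL (Fin n) (mixedSpace K)) := levelArchMeasure n K U₀ with hν
  haveI : ν.IsHaarMeasure := isHaarMeasure_levelArchMeasure hU₀o hU₀c
  obtain ⟨β, -, hβ_cont, hβ_cs, hβ_nonneg, hβ_one, hβ_supp⟩ :=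
    exists_dirac_admissibleWeightsGL (n := n) (K := K) ν
  obtain ⟨m, hm⟩ := (hβ_supp 𝒰 h𝒰).exists
  set η : (AdelicGroupData.gl n K).Adelic → ℝ := adelicWeight U₀ (β m) with hη_def
  have hηc : Continuous η := continuous_adelicWeight hU₀o (hβ_cont m)
  have hηs : HasCompactSupport η := hasCompactSupport_adelicWeight hU₀c (hβ_cs m)
  have hη0 : ∀ g, 0 ≤ η g := fun g => by
    rw [hη_def, adelicWeight_apply]
    exact mul_nonneg (hβ_nonneg m _) (Set.indicator_nonneg (fun _ _ => zero_le_one) g)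
  have hη1 : ∫ g, η g ∂(adelicHaar n K) = 1 := by
    rw [hη_def, integral_adelicWeight_eq hU₀o (hβ_cont m), ← hν, hβ_one m]
  have hη1C : ∫ g, (η g : ℂ) ∂(adelicHaar n K) = 1 := by
    rw [integral_complex_ofReal, hη1, Complex.ofReal_one]
  -- Step 3: the compact operator `R(η)` on `L²_cusp`
  set Wc := cuspidalSubspace n K μ with hWc
  set T := smoothedVectorL Wc hηc hηs with hT_def
  have hT : IsCompactOperator T :=
    GLnCuspidalSpectrum.isCompactOperator_smoothedVector_of_basicEstimate
      (GLnCuspidalSpectrum.norm_smoothedForm_le_of_isSiegelSetGL_holds n K μ) hηc hηs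
  haveI : CompleteSpace Wc.toSubmodule := Wc.isClosed.completeSpace_coe
  -- Step 4: the estimate `‖T v - v‖ ≤ ½ ‖v‖` for the classes of `V₀`
  have hfix : ∀ φ ∈ V₀, ∀ u ∈ U₀, R (GLn.ofFiniteAdelic n K u) (h.cl φ) = h.cl φ := by
    intro φ hφ u hu
    set φ' : (AdelicGroupData.gl n K).l2Representable μ := ⟨φ, h.le_l2Representable φ.2⟩ with hφ'
    have hf := (AdelicGroupData.gl n K).memLp_l2Rep φ'
    have h1 : h.cl φ = hf.toLp _ := rfl
    have hU : IsRightInvariantUnder (U₀.map (GLn.ofFiniteAdelic n K))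
        (invQuot (AdelicGroupData.gl n K) ((AdelicGroupData.gl n K).l2Rep φ')) := by
      rw [(AdelicGroupData.gl n K).invQuot_l2Rep φ']
      exact hlev φ hφ
    have key := rightRegular_mul_ofFiniteAdelic_toLp (μ := μ) hf hU hu 1
    rw [one_mul, map_one, one_apply_eq_self] at key
    rw [h1]
    exact key
  have hest : ∀ (φ : W) (hφ : φ ∈ V₀), ‖(T ⟨h.cl φ, hcusp φ hφ⟩ : Wc.toSubmodule) - ⟨h.cl φ, hcusp φ hφ⟩‖ ≤
      1 / 2 * ‖(⟨h.cl φ, hcusp φ hφ⟩ : Wc.toSubmodule)‖ := by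
    intro φ hφ
    set v : (AdelicGroupData.gl n K).L2 μ := h.cl φ with hv_def
    rw [Submodule.coe_norm, Submodule.coe_norm, Submodule.coe_sub, hT_def, smoothedVectorL_apply,
      coe_smoothedVector Wc hηc hηs]
    change ‖(∫ g, (η g : ℂ) • R g v ∂(adelicHaar n K)) - v‖ ≤ 1 / 2 * ‖v‖
    have hint1 : Integrable (fun g => (η g : ℂ) • R g v) (adelicHaar n K) :=
      integrable_ofReal_smul_rightRegular hηc hηs v
    have hint2 : Integrable (fun g => (η g : ℂ) • v) (adelicHaar n K) :=
      ((Complex.continuous_ofReal.comp hηc).smul continuous_const).integrable_of_hasCompactSupport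
        (hηs.comp_left Complex.ofReal_zero).smul_right
    have hv_eq : v = ∫ g, (η g : ℂ) • v ∂(adelicHaar n K) := by
      rw [integral_smul_const, hη1C, one_smul]
    have hdiff : (∫ g, (η g : ℂ) • R g v ∂(adelicHaar n K)) - v =
        ∫ g, ((η g : ℂ) • R g v - (η g : ℂ) • v) ∂(adelicHaar n K) := by
      rw [integral_sub hint1 hint2, ← hv_eq]
    rw [hdiff]
    have hptw : ∀ g, ‖(η g : ℂ) • R g v - (η g : ℂ) • v‖ ≤ η g * (1 / 2 * ‖v‖) := by
      intro g
      rw [← smul_sub, _root_.norm_smul, Complex.norm_real, Real.norm_of_nonneg (hη0 g)]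
      by_cases hg : η g = 0
      · rw [hg, zero_mul, zero_mul]
      · -- `g` lies in the slab with `g_∞ ∈ supp β ⊆ 𝒰`
        refine mul_le_mul_of_nonneg_left ?_ (hη0 g)
        have hg' : g ∈ levelSlab n K U₀ := by
          by_contra hns
          exact hg (by rw [hη_def, adelicWeight_of_not_mem _ hns])
        have hgU : GLn.toMixedAdelic n K g ∈ 𝒰 := by
          refine hm ?_
          rw [Function.mem_support]
          intro h0
          exact hg (by rw [hη_def, adelicWeight_apply, h0, zero_mul])
        rw [rightRegular_eq_of_mem_levelSlab (hfix φ hφ) hg']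
        exact hnear φ hφ _ hgU
    · calc ‖∫ g, (η g : ℂ) • R g v - (η g : ℂ) • v ∂(adelicHaar n K)‖
          ≤ ∫ g, ‖(η g : ℂ) • R g v - (η g : ℂ) • v‖ ∂(adelicHaar n K) := norm_integral_le_integral_norm _
        _ ≤ ∫ g, η g * (1 / 2 * ‖v‖) ∂(adelicHaar n K) :=
            integral_mono_of_nonneg (Eventually.of_forall fun g => norm_nonneg _)
              ((hηc.integrable_of_hasCompactSupport hηs).mul_const _) (Eventually.of_forall hptw)
        _ = 1 / 2 * ‖v‖ := by rw [integral_mul_const, hη1, one_mul]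
  -- Step 5: the closure of `cl(V₀)` inside `L²_cusp` is finite-dimensional
  set V₁ : Submodule ℂ Wc.toSubmodule := (V₀.map h.cl).comap Wc.toSubmodule.subtype with hV₁
  set V₂ : Submodule ℂ Wc.toSubmodule := V₁.topologicalClosure with hV₂
  have hV₂closed : IsClosed (V₂ : Set Wc.toSubmodule) := V₁.isClosed_topologicalClosure
  have hbound : ∀ v ∈ V₂, ‖T v - v‖ ≤ 1 / 2 * ‖v‖ := by
    have hcl : IsClosed {v : Wc.toSubmodule | ‖T v - v‖ ≤ 1 / 2 * ‖v‖} :=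
      isClosed_le (T.continuous.sub continuous_id).norm (continuous_const.mul continuous_norm)
    have hsub : (V₁ : Set Wc.toSubmodule) ⊆ {v | ‖T v - v‖ ≤ 1 / 2 * ‖v‖} := by
      intro v hv
      rw [SetLike.mem_coe, hV₁, Submodule.mem_comap, Submodule.mem_map] at hv
      obtain ⟨φ, hφ, hφv⟩ := hv
      have hv' : v = ⟨h.cl φ, hcusp φ hφ⟩ := Subtype.ext hφv.symm
      rw [Set.mem_setOf_eq, hv']
      exact hest φ hφ
    intro v hv
    have hv' : v ∈ closure (V₁ : Set Wc.toSubmodule) := by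
      rw [← Submodule.topologicalClosure_coe]
      exact hv
    exact hcl.closure_subset_iff.2 hsub hv'
  haveI : FiniteDimensional ℂ V₂ :=
    Literature.Analysis.OperatorTheory.finiteDimensional_of_isCompactOperator_of_norm_sub_le hT V₂
      hV₂closed (by norm_num : (1 / 2 : ℝ) < 1) hbound
  -- Step 6: `V₀ → V₂`, `φ ↦ [φ]`, is linear and injective
  have hmem : ∀ φ : V₀, (⟨h.cl φ, hcusp φ φ.2⟩ : Wc.toSubmodule) ∈ V₂ := fun φ =>
    V₁.le_topologicalClosure (show (⟨h.cl φ, hcusp φ φ.2⟩ : Wc.toSubmodule) ∈ V₁ from by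
      rw [hV₁, Submodule.mem_comap, Submodule.mem_map]
      exact ⟨(φ : W), φ.2, rfl⟩)
  let Ψ : V₀ →ₗ[ℂ] V₂ :=
    { toFun := fun φ => ⟨⟨h.cl φ, hcusp φ φ.2⟩, hmem φ⟩
      map_add' := fun φ ψ => Subtype.ext (Subtype.ext (by
        change h.cl ((φ : W) + (ψ : W)) = h.cl φ + h.cl ψ
        rw [map_add]))
      map_smul' := fun c φ => Subtype.ext (Subtype.ext (by
        change h.cl (c • (φ : W)) = c • h.cl φ
        rw [map_smul])) }
  have hΨ : Function.Injective Ψ := by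
    intro φ ψ hφψ
    have h1 : h.cl φ = h.cl ψ :=
      congrArg (fun v : V₂ => (((v : Wc.toSubmodule) : (AdelicGroupData.gl n K).L2 μ))) hφψ
    exact Subtype.ext (h.cl_injective h1)
  exact FiniteDimensional.of_injective Ψ hΨ

end Main

end Literature.NumberTheory.Automorphic
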